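import Literature.NumberTheory.Automorphic.ReciprocityGLnProofs
import HarnessLib

/-!
# Carayol's local–global compatibility for the Galois representations of Hilbert modular forms,
# in the unramified almost-everywhere form

Topic `Literature/NumberTheory/Automorphic`.  ONE named fact, no proofs.

For a regular algebraic cuspidal automorphic representation `π` of `GL₂(𝔸_K)` over a totally real
field `K` (the Borel–Jacquet model `CuspidalAutomorphicRepData 2 K hcpt` of the tree, i.e. a
cuspidal Hilbert eigenform of paritious weight `k_τ ≥ 2`, cf. the module docstring of
`HilbertModularGaloisRep.lean`) and an irreducible continuous `r : Γ_K → GL₂(ℚ̄_ℓ)` compatible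
with `π` at almost every finite place (`IsGaloisCompatibleAt`-style clause: `r` unramified at `v`
with the Frobenius polynomial of the Satake parameter), Carayol's Théorème (A) — the identity
`σ_λ|_{W_𝔭} ≃ σ_λ(π_𝔭)` at EVERY finite `𝔭 ∤ λ` — together with Kutzko's unramified dictionary
(Carayol 1986, §0.5) and Chebotarev–Brauer–Nesbitt (`r ≃ σ_λ`) gives, at every `w ∤ ℓ`:
`r` is compatible with `π` at `w`, and `r` unramified at `w` forces `π_w` unramified.  For
`[K : ℚ]` even, at the places where `π` has no discrete series, this is Taylor 1989 (Thms. 1–2) as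
recorded by Jarvis 1997, §7 (p. 18); the whole statement is (1) of Skinner 2009, §1 ("established
by Carayol, Wiles, Blasius and Rogawski, and Taylor").

This is, character for character, the inline hypothesis `hCar` ((C') of the module docstring) of
`Langlands1980_quadraticBaseChange_frobCompatible_of_carayol'`
(`QuadraticBaseChangeFrobCompatibleSplitAuxFieldProofs.lean`, §3), vendored as a named fact at the
operator's request (promote event 3026615, 2026-08-16) so that
`Langlands1980_quadraticBaseChange_frobCompatible` parks on four NAMED inputs (this fact and the
three Arthur–Clozel base-change facts) instead of an anonymous hypothesis; the one-line assembly
`Langlands1980_quadraticBaseChange_frobCompatible_of_facts` lives next to that theorem (it needs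
both files).  Deliberately NOT here: any Galois representation attached to `π` (existence is
lang.S27 `exists_galoisRep_of_regularAlgebraic`; irreducibility is
`galoisRep_GL2_totallyReal_irreducible`), and no proof.

## References

* H. Carayol, *Sur les représentations ℓ-adiques associées aux formes modulaires de Hilbert*,
  Ann. Sci. ÉNS (4) 19 (1986) 409–468, §0.3, §0.5, Théorème (A) (pp. 410–411). [CarayolASENS1986]
* R. Taylor, *On Galois representations associated to Hilbert modular forms*, Invent. Math. 98
  (1989) 265–280, Thms. 1–2. [TaylorInventMath1989]
* F. Jarvis, *On Galois representations associated to Hilbert modular forms*, J. reine angew.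
  Math. 491 (1997) 199–216, §7 (p. 18). [Jarvis1997]
* C. Skinner, *A note on the p-adic Galois representations attached to Hilbert modular forms*,
  Doc. Math. 14 (2009) 241–258, §1 (1). [Skinner2009]
-/

open scoped MatrixGroups Matrix NumberField Polynomial
open NumberField IsDedekindDomain Field Polynomial Filter

noncomputable section

namespace Literature.NumberTheory.Automorphic

open Literature.NumberTheory.GaloisRepresentations

/-- **Carayol's local–global compatibility, unramified almost-everywhere form (C').**  For `K`
totally real, `π` a regular algebraic cuspidal automorphic representation of `GL₂(𝔸_K)`, `ℓ` a
prime with `ι : ℚ̄_ℓ ≃ ℂ`, and `r : Γ_K → GL₂(ℚ̄_ℓ)` irreducible and compatible with `π` at almost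
every finite place `v` (Satake parameter `α`, `r` unramified at `v`, Frobenius polynomial
`arithFrobPolyOfSatake ι q_v 2 α`): at EVERY finite place `w ∤ ℓ`, `r` is compatible with `π` at
`w` (`IsGaloisCompatibleAt`) and `r` unramified at `w` implies `π` unramified at `w`.
Carayol 1986, Théorème (A) with §0.5 (and Chebotarev–Brauer–Nesbitt to identify `r` with `σ_λ`);
even degree / non-discrete-series places: Taylor 1989, Thms. 1–2 (Jarvis 1997, §7, p. 18); the
statement as a whole: Skinner 2009, §1 (1).  Verbatim the hypothesis `hCar` of
`Langlands1980_quadraticBaseChange_frobCompatible_of_carayol'`.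
[cite: CarayolASENS1986, Thm. (A) (pp. 410–411) with §0.3, §0.5] -/
def Carayol1986_unramifiedCompatibility : Prop :=
  ∀ {K : Type} [Field K] [NumberField K] (hcpt : isCompact_glFiniteIntegralLevel 2 K),
    IsTotallyReal K →
    ∀ (π : CuspidalAutomorphicRepData 2 K hcpt), π.1.IsRegularAlgebraic →
      ∀ (ℓ : ℕ) [Fact ℓ.Prime] (ι : PadicAlgCl ℓ ≃+* ℂ) (r : FramedGaloisRep K (PadicAlgCl ℓ) 2),
        r.toGaloisRep.IsIrreducible →
        (∀ᶠ v : HeightOneSpectrum (𝓞 K) in cofinite,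
          ∃ α : Multiset ℂ, π.1.HasSatakeParamAt v α ∧ r.IsUnramifiedAt v ∧
            r.HasFrobCharpolyAt v (arithFrobPolyOfSatake ι v.residueCard 2 α)) →
        ∀ w : HeightOneSpectrum (𝓞 K), ((ℓ : ℕ) : 𝓞 K) ∉ w.asIdeal →
          IsGaloisCompatibleAt π.1 ι r w ∧ (r.IsUnramifiedAt w → π.1.IsUnramifiedAt w)

end Literature.NumberTheory.Automorphic

end
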